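import Literature.NumberTheory.Automorphic.IdeleClassGroupFirstCohomologyAll
import Mathlib.RepresentationTheory.Homological.GroupCohomology.LowDegree
import HarnessLib

/-!
# The idele class group as an integral Galois representation, and axiom I of the global class
# formation in `groupCohomology` currency: `H¹(U, C_E) = 0` for every `U ≤ Gal(E/F)`
# (Tate, Cassels–Fröhlich Ch. VII §8–§9, Thm. 9.1; Lang, *Topics in Cohomology of Groups* III §3)

Topic `NumberTheory/Automorphic` (ideles, idele classes); namespace
`Literature.NumberTheory.Automorphic.IdeleClassGroup`.  One definition with a body (the representation) and
theorems; NO named fact, no instance, no notation.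

The tree's abstract class-formation theory (`Literature/Algebra/Homology/ClassModule.lean`: `IsClassModule A φ`
for `A : Rep k G`, axiom I = `∀ U : Subgroup G, IsZero (groupCohomology (Rep.res U.subtype A) 1)`; `TateTheorem.lean`)
is phrased on Mathlib's `Rep k G` / `groupCohomology`.  To feed the idele class group `C_E = 𝕀_E/Eˣ` of a finite
Galois extension of number fields `E/F` into it, this file packages the Galois action
`classGalAct σ : C_E →ₜ* C_E` (`IdeleClassCharacterConjugate`, "the action of `G` on `C_L` is that induced by its
action on `J_L`", Cassels–Fröhlich VII §8) as

* `IdeleClassGroup.galoisRep F E : Rep ℤ (E ≃ₐ[F] E)` on `Additive (IdeleClassGroup E)`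
  (`galoisRepresentation F E : Representation ℤ (E ≃ₐ[F] E) (Additive (IdeleClassGroup E))`, `ρ g = classGalAct g`),

and transcribes the element-form theorem `exists_classGalAct_div_eq_subgroup` (`IdeleClassGroupFirstCohomologyAll`:
every crossed homomorphism `U → C_E` is a coboundary, for every `U ≤ Gal(E/F)`) into

* **`isZero_H1_res_galoisRep`** — `IsZero (groupCohomology (Rep.res U.subtype (galoisRep F E)) 1)` for every
  subgroup `U ≤ Gal(E/F)`: **axiom I of `IsClassModule` for `(Gal(E/F), C_E)`** (Tate, Thm. 9.1 (2) `H¹(G, C_L) = 0`,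
  applied to every layer `E/E^U`);
* `isZero_H1_galoisRep` — `IsZero (groupCohomology (galoisRep F E) 1)`.

Axiom II (`H²` cyclic of order `[E:F]` with compatible fundamental classes) is not addressed here.

## References

* J. W. S. Cassels, A. Fröhlich (eds.), *Algebraic Number Theory* (1967), Ch. VII (J. Tate) §8 (the `G`-module
  `C_L`), §9 Thm. 9.1. [CasselsFrohlichANT1967]
* S. Lang, *Topics in Cohomology of Groups*, LNM 1625 (1996), Ch. III §3 (class modules). [Lang1996]
-/

noncomputable section

open NumberField CategoryTheory CategoryTheory.Limits groupCohomology
open scoped NumberField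

namespace Literature.NumberTheory.Automorphic

namespace IdeleClassGroup

open Literature.NumberTheory.GaloisRepresentations

variable (F E : Type) [Field F] [Field E] [Algebra F E] [NumberField E]

/-- **The idele class group `C_E` as an object of `Rep ℤ Gal(E/F)`** (the `G`-module `C_L` of the global class
formation): the additive group `Additive (C_E)`, `C_E = 𝕀_E / Eˣ`, with `g ∈ Aut(E/F)` acting by `classGalAct g`
("the action of `G` on `C_L` is that induced by its action on `J_L`").  The `AddCommGroup` / `ℤ`-module
structure is the one transported from the commutative group `C_E` (`Additive.addCommGroup`,
`AddCommGroup.toIntModule`), fixed here once and for all and carried by the `Rep` object.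
[cite: CasselsFrohlichANT1967, Ch. VII §8 (before Prop. 8.1)] -/
def galoisRep : Rep ℤ (E ≃ₐ[F] E) :=
  letI i₁ : AddCommGroup (Additive (IdeleClassGroup E)) := Additive.addCommGroup
  letI i₂ : Module ℤ (Additive (IdeleClassGroup E)) := AddCommGroup.toIntModule _
  Rep.of (X := Additive (IdeleClassGroup E))
    { toFun := fun g => AddMonoidHom.toIntLinearMap
        (AddMonoidHom.mk' (fun x => Additive.ofMul (classGalAct g (Additive.toMul x))) fun x y =>
          congrArg Additive.ofMul (map_mul (classGalAct g) (Additive.toMul x) (Additive.toMul y)))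
      map_one' := by
        refine LinearMap.ext fun x => ?_
        exact congrArg Additive.ofMul (classGalAct_one_apply (K := F) (Additive.toMul x))
      map_mul' := fun g h => by
        refine LinearMap.ext fun x => ?_
        exact congrArg Additive.ofMul (classGalAct_classGalAct g h (Additive.toMul x)).symm }

/-- The underlying module of `galoisRep F E` is `Additive (C_E)`. [cite: CasselsFrohlichANT1967, Ch. VII §8] -/
theorem galoisRep_V : (galoisRep F E).V = Additive (IdeleClassGroup E) := rfl

/-- The representation is the Galois action on classes: `ρ g x = g • x`.
[cite: CasselsFrohlichANT1967, Ch. VII §8 (before Prop. 8.1)] -/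
theorem galoisRep_ρ_apply (g : E ≃ₐ[F] E) (x : Additive (IdeleClassGroup E)) :
    (galoisRep F E).ρ g x = Additive.ofMul (classGalAct g (Additive.toMul x)) := rfl

variable {F E}
variable [NumberField F]

/-- **Axiom I of the global class formation, `groupCohomology` currency: `H¹(U, C_E) = 0` for every subgroup
`U ≤ Gal(E/F)`** of a finite Galois extension of number fields (Tate, Cassels–Fröhlich VII §9 Thm. 9.1 (2)
for the layer `E/E^U`; the shape `IsClassModule.isZero_H1` of `Algebra/Homology/ClassModule`).  Every `1`-cocycle
`x : U → Additive C_E` of the restricted representation is, multiplicatively, a crossed homomorphism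
`U → C_E`, hence a coboundary by `exists_classGalAct_div_eq_subgroup`, i.e. `x = d₀₁ c`.
[cite: CasselsFrohlichANT1967, Ch. VII §9 Thm. 9.1 (2)] -/
theorem isZero_H1_res_galoisRep [IsGalois F E] (U : Subgroup (E ≃ₐ[F] E)) :
    IsZero (groupCohomology (Rep.res U.subtype (galoisRep F E)) 1) := by
  refine @ModuleCat.isZero_of_subsingleton _ _ _ ⟨fun a b => ?_⟩
  have key : ∀ z : H1 (Rep.res U.subtype (galoisRep F E)), z = 0 := fun z =>
    H1_induction_on z fun x => (H1π_eq_zero_iff x).2 <| by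
      have hx := (mem_cocycles₁_iff (A := Rep.res U.subtype (galoisRep F E)) x).1 x.2
      obtain ⟨c, hc⟩ := exists_classGalAct_div_eq_subgroup (F := F) (E := E) U
        (fun a => Additive.toMul (x a)) fun a b => by
          change Additive.toMul (x (a * b)) = _
          rw [hx a b]
          rfl
      refine ⟨Additive.ofMul c, funext fun g => ?_⟩
      rw [d₀₁_hom_apply]
      exact congrArg Additive.ofMul (hc g)
  exact (key a).trans (key b).symm

/-- **`H¹(Gal(E/F), C_E) = 0`** in `groupCohomology` currency (the layer `U = Gal(E/F)` itself).
[cite: CasselsFrohlichANT1967, Ch. VII §9 Thm. 9.1 (2)] -/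
theorem isZero_H1_galoisRep [IsGalois F E] : IsZero (groupCohomology (galoisRep F E) 1) := by
  refine @ModuleCat.isZero_of_subsingleton _ _ _ ⟨fun a b => ?_⟩
  have key : ∀ z : H1 (galoisRep F E), z = 0 := fun z =>
    H1_induction_on z fun x => (H1π_eq_zero_iff x).2 <| by
      have hx := (mem_cocycles₁_iff (A := galoisRep F E) x).1 x.2
      obtain ⟨c, hc⟩ := exists_classGalAct_div_eq (F := F) (E := E)
        (fun g => Additive.toMul (x g)) fun g h => by
          change Additive.toMul (x (g * h)) = _
          rw [hx g h]
          rfl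
      refine ⟨Additive.ofMul c, funext fun g => ?_⟩
      rw [d₀₁_hom_apply]
      exact congrArg Additive.ofMul (hc g)
  exact (key a).trans (key b).symm

/-- **Axiom I along an injective homomorphism, element form**: for `f : H →* Gal(E/F)` injective (a layer
presented abstractly, as in `Algebra.Homology.SecondInequality.Hypotheses`), every crossed homomorphism
`u : H → C_E` for the action through `f` is a coboundary `a ↦ f(a) • c / c` (transport of
`exists_classGalAct_div_eq_subgroup` along `H ≃* f(H)`, `MonoidHom.ofInjective`).
[cite: CasselsFrohlichANT1967, Ch. VII §9 Thm. 9.1 (2)] -/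
theorem exists_classGalAct_div_eq_hom [IsGalois F E] {H : Type} [Group H] (f : H →* (E ≃ₐ[F] E))
    (hf : Function.Injective f) (u : H → IdeleClassGroup E)
    (hu : ∀ a b : H, u (a * b) = classGalAct (f a) (u b) * u a) :
    ∃ c : IdeleClassGroup E, ∀ a : H, classGalAct (f a) c / c = u a := by
  set e := MonoidHom.ofInjective hf with he
  have hfe : ∀ a : f.range, f (e.symm a) = (a : E ≃ₐ[F] E) := fun a => MonoidHom.apply_ofInjective_symm hf a
  obtain ⟨c, hc⟩ := exists_classGalAct_div_eq_subgroup (F := F) (E := E) f.range (fun a => u (e.symm a))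
    fun a b => by simp only [map_mul, hu, hfe]
  refine ⟨c, fun a => ?_⟩
  have h := hc (e a)
  rw [e.symm_apply_apply] at h
  exact h

/-- **Axiom I along an injective homomorphism, `groupCohomology` currency**: for every finite group `H` and
injective `f : H →* Gal(E/F)`, `H¹(H, Res_f C_E) = 0` — the field `isZero_H1` of the tree's
`Algebra.Homology.SecondInequality.Hypotheses` / `FieldFormation` criteria for `A = galoisRep F E`.
[cite: CasselsFrohlichANT1967, Ch. VII §9 Thm. 9.1 (2)] -/
theorem isZero_H1_res_hom_galoisRep [IsGalois F E] {H : Type} [Group H] (f : H →* (E ≃ₐ[F] E))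
    (hf : Function.Injective f) : IsZero (groupCohomology (Rep.res f (galoisRep F E)) 1) := by
  refine @ModuleCat.isZero_of_subsingleton _ _ _ ⟨fun a b => ?_⟩
  have key : ∀ z : H1 (Rep.res f (galoisRep F E)), z = 0 := fun z =>
    H1_induction_on z fun x => (H1π_eq_zero_iff x).2 <| by
      have hx := (mem_cocycles₁_iff (A := Rep.res f (galoisRep F E)) x).1 x.2
      obtain ⟨c, hc⟩ := exists_classGalAct_div_eq_hom (F := F) (E := E) f hf
        (fun a => Additive.toMul (x a)) fun a b => by
          change Additive.toMul (x (a * b)) = _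
          rw [hx a b]
          rfl
      refine ⟨Additive.ofMul c, funext fun g => ?_⟩
      rw [d₀₁_hom_apply]
      exact congrArg Additive.ofMul (hc g)
  exact (key a).trans (key b).symm

end IdeleClassGroup

end Literature.NumberTheory.Automorphic

end
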